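import Literature.Computability.QuantumComplexity.BosonReductionDecode
import Literature.Computability.QuantumComplexity.BosonReductionPrecision
import Literature.Computability.QuantumComplexity.BosonReductionAssembly
import Literature.Computability.QuantumComplexity.PermanentHardnessProofs
import Literature.Computability.QuantumComplexity.PermanentSearchRandomProofs
import HarnessLib

/-!
# Exact BosonSampling: discharge of `bosonReduction_mem_FP` (the reduction maps of AA13 Thm. 1.1 are in `FP`)

Family `quantum-advantage`; proofs file of `ExactBosonSamplingHardness.lean`. The named fact
`bosonReduction_mem_FP` there states that the three string maps of the reduction in Aaronson–Arkhipov's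
proof of Thm. 1.1 (*The computational complexity of linear optics*, Theory of Computing 9 (2013),
p. 178, eqs. (4.20)–(4.23); Lemma 4.4: "`U` can be computed in polynomial time given `X`") —
`bosonPre` (matrix code `⟨X⟩ ↦ ⟨x₀, y₀⟩`, the exact-dyadic instance at precision `gramPrecision X` and the
planted outcome), `bosonCountQuery qA cS` (the Stockmeyer count query) and `bosonCountPost qA` (the
rescaling `⌈(N/2ᵐ) 4^{tn} n!⌉`) — are polynomial-time. This file proves it
(`bosonReduction_mem_FP_holds`), on Mathlib's `TM2` model through the tree's `FP` algebra, by
exhibiting brick compositions that agree with the three maps on **every** string: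

* `bosonPreF = bosonPre` (`bosonPreF_eq_bosonPre`): test validity (`BosonFP.validQF`, the exact acceptance
  condition `CodeOK` of `encodingIntMatrix.decode`, `encodingIntMatrix_decode` of
  `AlgebraicComplexity/PermanentCodeTranscoder.lean`), canonicalise
  (`BosonFP.canonQF`), and run the machine of `BosonReductionMachine.lean` at the canonical precision
  (`BosonFP.bPreP`, `BosonReductionPrecision.lean`); invalid strings give `ε`, as `bosonPre` does;
* `bosonQueryF qA cS = bosonCountQuery qA cS` (`bosonQueryF_eq`): pairing projections, `bosonPre`, polynomial
  evaluations in unary (`polyFn`), a prefix of the coins (`takeFn`) — all total bricks, so the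
  identity holds on malformed queries too;
* `bosonPostF qA = bosonCountPost qA` (`bosonPostF_eq`): validity test, then `bin ⌈(N/2ᵐ) 4^{tn} n!⌉` with
  `N = decodeNat a` of an arbitrary answer string (`Brick.canonF`), `n`, `t = gramPrecision`, `n!`
  read off the canonical code (`BosonFP.factF`, `BosonFP.tUF`), `m = qA |x₀|` from `bPreP`, and the
  ceiling as `(K + 2ᵐ − 1) / 2ᵐ` (`BosonFP.nat_ceil_div_two_pow`).

Appended (the seat of the headline fact): **`PSharpP_subset_BPPRelClass_NP_of_uniformExactBosonSampling_holds`**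
— the fully discharged AA13 Thm. 1.1 (uniform-sampler form): the assembly
`PSharpP_subset_BPPRelClass_NP_of_uniformExactBosonSampling_of_valiant` of `BosonReductionAssembly.lean`
(Stockmeyer's theorem `StockMachine.stockmeyerApproxCounting_holds`, the oracle compositions, the
`BosonSampling` reduction machine) fed with the two remaining facts, now theorems of the tree:
Valiant's theorem `permanent01_isSharpPHardFun_holds` (`PermanentHardnessProofs.lean`) and the
polynomial-time randomised search `PerSearch.randSearchAlg_isPolyTime_holds`
(`PermanentSearchRandomProofs.lean`).

## References

* S. Aaronson, A. Arkhipov, *The computational complexity of linear optics*, Theory of Computing 9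
  (2013), Lemma 4.4 and proof of Thm. 1.1, eqs. (4.20)–(4.23) (p. 178); Def. 2.4 (p. 163).
* S. Arora, B. Barak, *Computational Complexity: A Modern Approach*, CUP 2009, §1.3 (polynomial
  time is closed under composition and polynomially bounded loops), §0.1 (codes of tuples).
-/

namespace Literature.Computability.QuantumComplexity

namespace BosonFP

open _root_.Computability Polynomial Literature.Computability.Complexity
  Literature.Computability.Complexity.OracleCompose Literature.Computability.Complexity.Brick
  Literature.Computability.Complexity.Plumb Literature.Computability.Complexity.HashBricks
  Literature.Computability.Complexity.CanonCode BosonCodes Finset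
open Literature.Computability.AlgebraicComplexity (intOfCode codeDim codeEntry CodeOK encodingIntMatrix_decode)

/-! ### `bosonPre ∈ FP` -/

/-- **The pre-processing map as a brick**: if the matrix code is valid, the machine at the canonical
precision on the canonical code; otherwise `ε`. [cite: AaronsonArkhipovToC2013, proof of Thm. 1.1 (p. 178)] -/
noncomputable def bosonPreF : List Bool → List Bool := iteFn validQF (bPreP ∘ canonQF) (fun _ => [])

/-- `bosonPreF ∈ FP`. [cite: AroraBarak2009, §1.3] -/
theorem bosonPreF_mem_FP : bosonPreF ∈ FP :=
  iteFn_mem_FP validQF_mem_FP (comp_mem_FP bPreP_mem_FP canonQF_mem_FP) (const_mem_FP _)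

/-- `bosonPre` on a string accepted by the decoder: the instance of the decoded matrix at its
canonical precision. [folklore] -/
theorem bosonPre_of_codeOK {q : List Bool} (h : CodeOK q) :
    bosonPre q = boolPair
      (gramInstanceCode (Matrix.of fun i j : Fin (codeDim q) => intOfCode (codeEntry q i j))
        (tPrec fun i j : Fin (codeDim q) => intOfCode (codeEntry q i j)))
      (diagOutcomeCode (codeDim q) (tPrec fun i j : Fin (codeDim q) => intOfCode (codeEntry q i j))) := by
  unfold bosonPre
  rw [encodingIntMatrix_decode, if_pos h]
  rfl

/-- `bosonPre` on a string rejected by the decoder: `ε`. [folklore] -/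
theorem bosonPre_of_not_codeOK {q : List Bool} (h : ¬ CodeOK q) : bosonPre q = [] := by
  unfold bosonPre
  rw [encodingIntMatrix_decode, if_neg h]

/-- **`bosonPreF = bosonPre` on every string.** [folklore] -/
theorem bosonPreF_eq_bosonPre : bosonPreF = bosonPre := by
  funext q
  rw [bosonPreF, iteFn_of_oneBit oneBit_validQF, validQF_apply]
  by_cases h : CodeOK q
  · rw [if_pos (by simp [h]), Function.comp_apply, canonQF_eq_qcode h, bPreP_apply, bosonPre_of_codeOK h]
  · rw [if_neg (by simp [h]), bosonPre_of_not_codeOK h]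

/-- **`bosonPre ∈ FP`.** [cite: AaronsonArkhipovToC2013, Lemma 4.4 (p. 178), polynomial-time computability] -/
theorem bosonPre_mem_FP : bosonPre ∈ FP := bosonPreF_eq_bosonPre ▸ bosonPreF_mem_FP

/-! ### `bosonCountQuery qA cS ∈ FP` -/

section Query

/-- `⟨x₀, y₀⟩ = bosonPre q` from `w = ⟨⟨q, s⟩, u⟩`. [folklore] -/
noncomputable def preQ : List Bool → List Bool := bosonPre ∘ qW

/-- `1ᵐ`, `m = qA |x₀|`. [folklore] -/
noncomputable def mQry (qA : Polynomial ℕ) : List Bool → List Bool := polyFn qA ∘ fstF ∘ preQ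

/-- `1ᵏ`, `k = |s|` (the confidence field read in unary, whatever its symbols). [folklore] -/
noncomputable def kQry : List Bool → List Bool := polyFn X ∘ kW

/-- `1^{ℓ'}`, `ℓ' = cS (|⟨x₀,y₀⟩| + m + 1 + k)`. [folklore] -/
noncomputable def ellQry (qA cS : Polynomial ℕ) : List Bool → List Bool :=
  polyFn cS ∘ appF ∘ fanoutFn (appF ∘ fanoutFn preQ (mQry qA)) (List.cons true ∘ kQry)

/-- **The count query as a brick**: `⟨⟨⟨x₀,y₀⟩, 1ᵐ, 1¹, 1ᵏ⟩, u ↾ ℓ'⟩`. [cite: AaronsonArkhipovToC2013, proof of Thm. 1.1 (p. 178)] -/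
noncomputable def bosonQueryF (qA cS : Polynomial ℕ) : List Bool → List Bool :=
  fanoutFn (fanoutFn preQ (fanoutFn (mQry qA) (fanoutFn (fun _ => [true]) kQry))) (takeFn ∘ fanoutFn (ellQry qA cS) uW)

/-- `bosonQueryF qA cS ∈ FP`. [cite: AroraBarak2009, §1.3] -/
theorem bosonQueryF_mem_FP (qA cS : Polynomial ℕ) : bosonQueryF qA cS ∈ FP := by
  have hq : qW ∈ FP := comp_mem_FP fstF_mem_FP fstF_mem_FP
  have hk : kQry ∈ FP := comp_mem_FP (polyFn_mem_FP X) (comp_mem_FP sndF_mem_FP fstF_mem_FP)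
  have hpre : preQ ∈ FP := comp_mem_FP bosonPre_mem_FP hq
  have hm : mQry qA ∈ FP := comp_mem_FP (polyFn_mem_FP qA) (comp_mem_FP fstF_mem_FP hpre)
  have hell : ellQry qA cS ∈ FP := comp_mem_FP (polyFn_mem_FP cS) (comp_mem_FP appF_mem_FP
    (fanoutFn_mem_FP (comp_mem_FP appF_mem_FP (fanoutFn_mem_FP hpre hm)) (comp_mem_FP (cons_mem_FP true) hk)))
  exact fanoutFn_mem_FP (fanoutFn_mem_FP hpre (fanoutFn_mem_FP hm (fanoutFn_mem_FP (const_mem_FP _) hk)))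
    (comp_mem_FP takeFn_mem_FP (fanoutFn_mem_FP hell sndF_mem_FP))

/-- `bosonCountQuery` unfolded: `⟨⟨⟨x₀,y₀⟩, 1ᵐ, 1¹, 1ᵏ⟩, u ↾ ℓ'⟩` on every string `w = ⟨⟨q, s⟩, u⟩`
(`k = |s|`). [folklore] -/
theorem bosonCountQuery_apply (qA cS : Polynomial ℕ) (w : List Bool) :
    bosonCountQuery qA cS w =
      boolPair (boolPair (bosonPre (boolUnpair (boolUnpair w).1).1)
        (boolPair (ones (bosonCoinLen qA (boolUnpair (boolUnpair w).1).1))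
          (boolPair [true] (ones (boolUnpair (boolUnpair w).1).2.length))))
        ((boolUnpair w).2.take
          (bosonCoinBound qA cS (boolUnpair (boolUnpair w).1).1 (boolUnpair (boolUnpair w).1).2.length)) := by
  rw [bosonCountQuery, countQuery, perSqParse]
  simp only [OracleCompose.unaryEncodeNat_eq_replicate, unaryDecodeNat]
  rfl

/-- **`bosonQueryF qA cS = bosonCountQuery qA cS` on every string.** [folklore] -/
theorem bosonQueryF_eq (qA cS : Polynomial ℕ) : bosonQueryF qA cS = bosonCountQuery qA cS := by
  funext w
  have hpre : preQ w = bosonPre (boolUnpair (boolUnpair w).1).1 := rfl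
  have hm : mQry qA w = ones (bosonCoinLen qA (boolUnpair (boolUnpair w).1).1) := by
    rw [mQry, Function.comp_apply, Function.comp_apply, hpre, polyFn_apply]; rfl
  have hk : kQry w = ones (boolUnpair (boolUnpair w).1).2.length := by
    rw [kQry, Function.comp_apply, polyFn_apply, eval_X]; rfl
  have hlen : ((appF ∘ fanoutFn (appF ∘ fanoutFn preQ (mQry qA)) (List.cons true ∘ kQry)) w).length =
      (bosonPre (boolUnpair (boolUnpair w).1).1).length + bosonCoinLen qA (boolUnpair (boolUnpair w).1).1 + 1 +
        (boolUnpair (boolUnpair w).1).2.length := by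
    simp only [Function.comp_apply, fanoutFn_apply, hpre, hm, hk, appF_boolPair, List.length_append, List.length_cons,
      ones, List.length_replicate]
    omega
  have hell : ellQry qA cS w =
      ones (bosonCoinBound qA cS (boolUnpair (boolUnpair w).1).1 (boolUnpair (boolUnpair w).1).2.length) := by
    rw [ellQry, Function.comp_apply, polyFn_apply, hlen, bosonCoinBound]
  rw [bosonCountQuery_apply, bosonQueryF, fanoutFn_apply, fanoutFn_apply, fanoutFn_apply, fanoutFn_apply, hpre, hm, hk,
    Function.comp_apply, fanoutFn_apply, hell, takeFn_boolPair]
  simp only [uW, sndF, ones, List.length_replicate]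

/-- **`bosonCountQuery qA cS ∈ FP`.** [cite: AaronsonArkhipovToC2013, proof of Thm. 1.1 (p. 178)] -/
theorem bosonCountQuery_mem_FP (qA cS : Polynomial ℕ) : bosonCountQuery qA cS ∈ FP :=
  bosonQueryF_eq qA cS ▸ bosonQueryF_mem_FP qA cS

end Query

/-! ### `bosonCountPost qA ∈ FP` -/

section Post

/-- On `z = ⟨w, a⟩`: the canonical matrix code of the query's matrix. [folklore] -/
noncomputable def cqZ : List Bool → List Bool := canonQF ∘ qW ∘ wZ

/-- On `z`: its padded context. [folklore] -/
noncomputable def ctxZ : List Bool → List Bool := mkCtx ∘ cqZ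

/-- On `z`: `1ⁿ`. [folklore] -/
noncomputable def nUZP : List Bool → List Bool := onesN ∘ ctxZ

/-- On `z`: `1ᵗ`, `t = gramPrecision`. [folklore] -/
noncomputable def tUZP : List Bool → List Bool := tUF ∘ ctxZ

/-- On `z`: `bin 4^{tn} = 0^{2tn} 1`. [folklore] -/
noncomputable def pow4tnP : List Bool → List Bool :=
  appF ∘ fanoutFn (Kannan.zerosFn ∘ umulFn ∘ fanoutFn (onesMulFn 2 ∘ tUZP) nUZP) (fun _ => [true])

/-- On `z`: `1ᵐ`, `m = qA |x₀|` (the sampler's coin count on the instance). [folklore] -/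
noncomputable def mUZ (qA : Polynomial ℕ) : List Bool → List Bool := polyFn qA ∘ fstF ∘ bPreP ∘ cqZ

/-- On `z`: `bin (N · 4^{tn} · n!)`, `N = decodeNat a`. [folklore] -/
noncomputable def rescaleKF : List Bool → List Bool :=
  prodFn ∘ fanoutFn (prodFn ∘ fanoutFn (canonF ∘ aZ) pow4tnP) (factF ∘ cqZ)

/-- On `z`: `bin ⌈(N / 2ᵐ) · 4^{tn} · n!⌉ = bin ((K + (2ᵐ − 1)) / 2ᵐ)`. [cite: AaronsonArkhipovToC2013, proof of Thm. 1.1, eq. (4.23) (p. 178)] -/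
noncomputable def postCoreP (qA : Polynomial ℕ) : List Bool → List Bool :=
  norm ∘ dropFn ∘ fanoutFn (mUZ qA) (addFn ∘ fanoutFn rescaleKF (mUZ qA))

/-- **The post-processing map as a brick**: if the query's matrix code is valid, the rescaled count;
otherwise `ε`. [cite: AaronsonArkhipovToC2013, proof of Thm. 1.1, eq. (4.23) (p. 178)] -/
noncomputable def bosonPostF (qA : Polynomial ℕ) : List Bool → List Bool :=
  iteFn (validQF ∘ qW ∘ wZ) (postCoreP qA) (fun _ => [])

/-- `bosonPostF qA ∈ FP`. [cite: AroraBarak2009, §1.3] -/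
theorem bosonPostF_mem_FP (qA : Polynomial ℕ) : bosonPostF qA ∈ FP := by
  have hq : (qW ∘ wZ) ∈ FP := comp_mem_FP (comp_mem_FP fstF_mem_FP fstF_mem_FP) fstF_mem_FP
  have hcq : cqZ ∈ FP := comp_mem_FP canonQF_mem_FP hq
  have hctx : ctxZ ∈ FP := comp_mem_FP mkCtx_mem_FP hcq
  have hn : nUZP ∈ FP := comp_mem_FP accessors_mem_FP.2.1 hctx
  have ht : tUZP ∈ FP := comp_mem_FP tUF_mem_FP hctx
  have h4 : pow4tnP ∈ FP := comp_mem_FP appF_mem_FP (fanoutFn_mem_FP (comp_mem_FP Kannan.zerosFn_mem_FP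
    (comp_mem_FP umulFn_mem_FP (fanoutFn_mem_FP (comp_mem_FP (onesMulFn_mem_FP 2) ht) hn))) (const_mem_FP _))
  have hm : mUZ qA ∈ FP := comp_mem_FP (polyFn_mem_FP qA) (comp_mem_FP fstF_mem_FP (comp_mem_FP bPreP_mem_FP hcq))
  have hK : rescaleKF ∈ FP := comp_mem_FP prodFn_mem_FP (fanoutFn_mem_FP (comp_mem_FP prodFn_mem_FP
    (fanoutFn_mem_FP (comp_mem_FP canonF_mem_FP sndF_mem_FP) h4)) (comp_mem_FP factF_mem_FP hcq))
  have hcore : postCoreP qA ∈ FP :=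
    comp_mem_FP norm_mem_FP (comp_mem_FP dropFn_mem_FP (fanoutFn_mem_FP hm (comp_mem_FP addFn_mem_FP (fanoutFn_mem_FP hK hm))))
  exact iteFn_mem_FP (comp_mem_FP validQF_mem_FP hq) hcore (const_mem_FP _)

/-- `bosonCountPost` on a query whose matrix code the decoder rejects: `ε`. [folklore] -/
theorem bosonCountPost_of_not_codeOK (qA : Polynomial ℕ) {z : List Bool}
    (h : ¬ CodeOK (boolUnpair (boolUnpair (boolUnpair z).1).1).1) : bosonCountPost qA z = [] := by
  unfold bosonCountPost
  simp only [perSqParse]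
  rw [encodingIntMatrix_decode, if_neg h]

/-- `bosonCountPost` on a query whose matrix code `q` the decoder accepts: the rescaled count for the
decoded matrix. [folklore] -/
theorem bosonCountPost_of_codeOK (qA : Polynomial ℕ) {z : List Bool}
    (h : CodeOK (boolUnpair (boolUnpair (boolUnpair z).1).1).1) :
    bosonCountPost qA z = encodeNat (bosonRescale (codeDim (boolUnpair (boolUnpair (boolUnpair z).1).1).1)
      (tPrec fun i j : Fin (codeDim (boolUnpair (boolUnpair (boolUnpair z).1).1).1) =>
        intOfCode (codeEntry (boolUnpair (boolUnpair (boolUnpair z).1).1).1 i j))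
      (decodeNat (boolUnpair z).2) (bosonCoinLen qA (boolUnpair (boolUnpair (boolUnpair z).1).1).1)) := by
  unfold bosonCountPost
  simp only [perSqParse]
  rw [encodingIntMatrix_decode, if_pos h]
  rfl

/-- The sampler's coin count on an accepted matrix code, through the decoded matrix. [folklore] -/
theorem bosonCoinLen_of_codeOK (qA : Polynomial ℕ) {q : List Bool} (h : CodeOK q) :
    bosonCoinLen qA q = qA.eval (gramInstanceCode (Matrix.of fun i j : Fin (codeDim q) => intOfCode (codeEntry q i j))
      (tPrec fun i j : Fin (codeDim q) => intOfCode (codeEntry q i j))).length := by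
  rw [bosonCoinLen, bosonPre_of_codeOK h, boolUnpair_boolPair]

/-- **`bosonPostF qA = bosonCountPost qA` on every string.** [folklore] -/
theorem bosonPostF_eq (qA : Polynomial ℕ) : bosonPostF qA = bosonCountPost qA := by
  funext z
  set q : List Bool := (boolUnpair (boolUnpair (boolUnpair z).1).1).1 with hq_def
  set a : List Bool := (boolUnpair z).2 with ha_def
  have hqz : (qW ∘ wZ) z = q := rfl
  have hval : (validQF ∘ qW ∘ wZ) z = [decide (CodeOK q)] := by
    rw [show (validQF ∘ qW ∘ wZ) z = validQF ((qW ∘ wZ) z) from rfl, hqz, validQF_apply]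
  rw [bosonPostF, iteFn_apply hval]
  by_cases hv : CodeOK q
  · rw [if_pos (decide_eq_true hv), bosonCountPost_of_codeOK qA hv, bosonCoinLen_of_codeOK qA hv]
    -- the decoded matrix and the values of the pieces
    set M : Fin (codeDim q) → Fin (codeDim q) → ℤ := fun i j => intOfCode (codeEntry q i j) with hM
    set m : ℕ := qA.eval (gramInstanceCode (Matrix.of M) (tPrec M)).length with hm_def
    have hcq : cqZ z = qcode M := by rw [cqZ, Function.comp_apply, hqz, canonQF_eq_qcode hv]
    have hctx : ctxZ z = ctxOf M := by rw [ctxZ, Function.comp_apply, hcq, mkCtx_qcode]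
    have hn : nUZP z = ones (codeDim q) := by rw [nUZP, Function.comp_apply, hctx, onesN_ctxOf]
    have ht : tUZP z = ones (tPrec M) := by rw [tUZP, Function.comp_apply, hctx, tUF_ctxOf]
    have hmz : mUZ qA z = ones m := by
      rw [mUZ, Function.comp_apply, Function.comp_apply, Function.comp_apply, hcq, bPreP_apply, fstF_boolPair,
        polyFn_apply]
    have h4 : pow4tnP z = encodeNat (4 ^ (tPrec M * codeDim q)) := by
      rw [show (4 : ℕ) ^ (tPrec M * codeDim q) = 2 ^ (2 * tPrec M * codeDim q) by
        rw [show (4 : ℕ) = 2 ^ 2 by norm_num, ← pow_mul, mul_assoc], Com.encodeNat_two_pow]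
      simp [pow4tnP, hn, ht, onesMulFn, ones]
    have hf : (factF ∘ cqZ) z = encodeNat (codeDim q).factorial := by rw [Function.comp_apply, hcq, factF_apply]
    have ha : (canonF ∘ aZ) z = canonF a := rfl
    have hK : rescaleKF z = encodeNat (decodeNat a * 4 ^ (tPrec M * codeDim q) * (codeDim q).factorial) := by
      rw [rescaleKF, Function.comp_apply, fanoutFn_apply, hf, Function.comp_apply, fanoutFn_apply, ha, h4, prodFn_boolPair,
        prodFn_boolPair, bitsToNat_canonF, bitsToNat_encodeNat, bitsToNat_encodeNat, bitsToNat_encodeNat]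
    rw [postCoreP, Function.comp_apply, Function.comp_apply, fanoutFn_apply, hmz, Function.comp_apply,
      fanoutFn_apply, hK, hmz, addFn_boolPair, bitsToNat_encodeNat, bitsToNat_ones, dropFn_boolPair, norm_eq_encodeNat,
      bitsToNat_drop, bosonRescale, nat_ceil_div_two_pow, bitsToNat_encodeNat]
    simp only [ones, List.length_replicate]
    apply congrArg encodeNat
    rw [← Nat.add_sub_assoc Nat.one_le_two_pow, Nat.mul_assoc]
  · rw [if_neg (by simp [hv]), bosonCountPost_of_not_codeOK qA hv]

/-- **`bosonCountPost qA ∈ FP`.** [cite: AaronsonArkhipovToC2013, proof of Thm. 1.1, eq. (4.23) (p. 178)] -/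
theorem bosonCountPost_mem_FP (qA : Polynomial ℕ) : bosonCountPost qA ∈ FP := bosonPostF_eq qA ▸ bosonPostF_mem_FP qA

end Post

end BosonFP

/-- **Discharge of `bosonReduction_mem_FP`** (AA13 Lemma 4.4: "`U` can be computed in polynomial time
given `X`", together with the book-keeping of the proof of Thm. 1.1, p. 178): the reduction maps
`bosonPre`, `bosonCountQuery qA cS` and `bosonCountPost qA` are polynomial-time computable on
Mathlib's `TM2` model — by the `FP` bricks `BosonFP.bosonPreF`, `BosonFP.bosonQueryF`, `BosonFP.bosonPostF`, which
agree with them on every string. [cite: AaronsonArkhipovToC2013, Lemma 4.4 (p. 178) and proof of Thm. 1.1 (p. 178)] -/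
theorem bosonReduction_mem_FP_holds : bosonReduction_mem_FP :=
  ⟨BosonFP.bosonPre_mem_FP, BosonFP.bosonCountQuery_mem_FP, BosonFP.bosonCountPost_mem_FP⟩

open Literature.Computability.Complexity in
/-- **The corrected S20 from its printed ingredients, book-keeping discharged**: the assembly
`PSharpP_subset_BPPRelClass_NP_of_uniformExactBosonSampling_of_facts'''` of
`ExactBosonSamplingHardness.lean` with `bosonReduction_mem_FP` fed in from `bosonReduction_mem_FP_holds`;
the remaining hypotheses are Stockmeyer's theorem (AA13 Thm. 4.1), `P^{FP^L} ⊆ P^L` and AA13 Thm. 4.3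
in randomised-oracle form. [cite: AaronsonArkhipovToC2013, Thm. 1.1, proof (p. 178)] -/
theorem PSharpP_subset_BPPRelClass_NP_of_uniformExactBosonSampling_of_facts''''
    (hStock : stockmeyerApproxCounting) (hcomp : PRel_subset_PRel_of_mem_FPRel)
    (hHard : PSharpP_subset_BPPRel_of_perSqRandOracleSolves) :
    PSharpP_subset_BPPRelClass_NP_of_uniformExactBosonSampling :=
  PSharpP_subset_BPPRelClass_NP_of_uniformExactBosonSampling_of_facts''' hStock hcomp hHard bosonReduction_mem_FP_holds

/-- **Aaronson–Arkhipov, Thm. 1.1 (exact case, uniform samplers), fully discharged**: if some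
polynomial-time classical algorithm samples the `BosonSampling` distribution exactly (with a
polynomial coin budget), then `P^{#P} ⊆ BPP^{NP}`. All ingredients are theorems of the tree:
Stockmeyer approximate counting (Thm. 4.1), Valiant's `#P`-hardness of the `0/1` permanent
(`permanent01_isSharpPHardFun_holds`), the randomised permanent search of Thm. 4.3 as a
polynomial-time oracle algorithm (`PerSearch.randSearchAlg_isPolyTime_holds`), the reduction maps of
Lemma 4.4 / eqs. (4.20)–(4.23) in `FP`, and the oracle-machine compositions. [cite: AaronsonArkhipovToC2013, Thm. 1.1, proof (p. 178)] -/
theorem PSharpP_subset_BPPRelClass_NP_of_uniformExactBosonSampling_holds :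
    PSharpP_subset_BPPRelClass_NP_of_uniformExactBosonSampling :=
  PSharpP_subset_BPPRelClass_NP_of_uniformExactBosonSampling_of_valiant permanent01_isSharpPHardFun_holds
    PerSearch.randSearchAlg_isPolyTime_holds

end Literature.Computability.QuantumComplexity
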